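import Literature.InformationTheory.QuantumCodes.QuantumExpanderNoisySyndromeTheorem13Printed
import HarnessLib

/-!
# Small-set-flip with a NOISY syndrome (Fawzi–Grospellier–Leverrier, FOCS 2018), part 15: Theorem 13 with the TWO noise rates of Def. 9 —
# the residual's local-stochastic parameter depends on the SYNDROME rate `p_synd` only — PROOF

Index of sources: `[cite: FawziGrospellierLeverrier2018FT]` = Fawzi–Grospellier–Leverrier, FOCS 2018 / arXiv:1808.03821, Def. 9 (p0011 L20-27: "`ℙ[S ⊆ E, T ⊆ D] ≤ p^{|S|} q^{|T|}`"),
Thm. 13 (p0016 L66-73: "`E_ls` has a local stochastic distribution with parameter `K p_synd^{1/c₀}` where `K` is a constant independent of `p_synd`").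

Topic `Literature/InformationTheory/QuantumCodes` (venture QEC, row 04 `prover-qec-type-04` gen 8, line L-SSF-NOISY = PARTITION v2.48 D50.L8, node N26). Parts 13–14 used ONE
parameter for the joint law. Here the two rates are separated as in print: the succ-complement clause uses a joint local-stochastic parameter `p` (e.g. `max(p_phys, p_synd)`),
while the local-stochastic clause for `E_ls` uses only the syndrome-side bound `Σ_{X ⊇ T.map inr} μ X ≤ p_synd^{|T|}` (Def. 9 with `S = ∅`), giving the parameter
`2^{1+max Δ}·p_synd^{1/c₀}`.

* `sum_filter_witness_le_of_syndromeBound` — the per-witness bound from the syndrome-side bound alone;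
* ★ `fgl18b_theorem13_syndromeRate` — generic `G'`: on succ, `Σ_{X ∈ succ, S ⊆ supp E_ls(X)} μ X ≤ F(y)^{|S|}`, `y = 2^{max Δ}·p_synd^{1/c₀}`;
* ★ `fgl18b_theorem13_twoRates` — concrete `𝒢 = syndromeAdjGraph`, all three clauses: succᶜ weight via the joint parameter `p`, parameter `2^{1+max Δ}·p_synd^{1/c₀}` for `E_ls`.

Column word: PROVED (kernel); no definitions (Def. 9 is written as two hypotheses), no named facts.
-/

namespace Literature.InformationTheory.QuantumCodes

open Finset Matrix Literature.Probability.LatticeModels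

namespace QuantumExpander

variable {A B : Type*} [Fintype A] [Fintype B] [DecidableEq A] [DecidableEq B]

omit [Fintype A] [Fintype B] [DecidableEq A] [DecidableEq B] in
/-- Union bound helper (nonnegative weights), generic. [folklore] -/
private theorem sum_biUnion_le_sum_gen {α β : Type*} [DecidableEq β] (T : Finset α) (B' : α → Finset β) (W : β → ℝ)
    (hW : ∀ b, 0 ≤ W b) : ∑ b ∈ T.biUnion B', W b ≤ ∑ a ∈ T, ∑ b ∈ B' a, W b := by
  classical
  induction T using Finset.induction_on with
  | empty => simp
  | insert a T ha ih =>
    rw [Finset.biUnion_insert, Finset.sum_insert ha]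
    have hu : ∑ b ∈ B' a ∪ T.biUnion B', W b ≤ ∑ b ∈ B' a, W b + ∑ b ∈ T.biUnion B', W b := by
      rw [← Finset.sum_union_inter]
      have : 0 ≤ ∑ b ∈ B' a ∩ T.biUnion B', W b := Finset.sum_nonneg fun b _ => hW b
      linarith
    linarith

omit [Fintype A] [Fintype B] [DecidableEq A] [DecidableEq B] in
/-- **`ℙ[w ≤ c₀·|D(X) ∩ N|] ≤ 2^{|N|}·q^{⌈w/c₀⌉}` from the syndrome-side bound alone** (`Σ_{X ⊇ T.map inr} μ X ≤ q^{|T|}`, `μ ≥ 0`).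
[cite: FawziGrospellierLeverrier2018FT, proof of Thm 13, first display (arXiv p0021 L26-33); Def 9] -/
theorem sum_filter_witness_le_of_syndromeBound {Q C : Type*} [Fintype Q] [Fintype C] [DecidableEq Q] [DecidableEq C]
    {μ : Finset (Q ⊕ C) → ℝ} (hμnn : ∀ X, 0 ≤ μ X) {q : ℝ}
    (hμD : ∀ T : Finset C, ∑ X ∈ univ.filter (fun X : Finset (Q ⊕ C) => T.map Function.Embedding.inr ⊆ X), μ X ≤ q ^ T.card)
    (hq0 : 0 ≤ q) (hq1 : q ≤ 1) (N : Finset C) {c₀ w : ℝ} (hc₀ : 0 < c₀) :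
    ∑ X ∈ univ.filter (fun X : Finset (Q ⊕ C) =>
        w ≤ c₀ * (((univ.filter fun c : C => Sum.inr c ∈ X) ∩ N).card : ℝ)), μ X
      ≤ (2 : ℝ) ^ N.card * q ^ ⌈w / c₀⌉₊ := by
  classical
  set good : Finset (Finset C) := N.powerset.filter fun T => w ≤ c₀ * (T.card : ℝ) with hgood
  have hcover : univ.filter (fun X : Finset (Q ⊕ C) =>
        w ≤ c₀ * (((univ.filter fun c : C => Sum.inr c ∈ X) ∩ N).card : ℝ))
      ⊆ good.biUnion fun T => univ.filter fun X : Finset (Q ⊕ C) => T.map Function.Embedding.inr ⊆ X := by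
    intro X hX
    rw [Finset.mem_filter] at hX
    rw [Finset.mem_biUnion]
    refine ⟨(univ.filter fun c : C => Sum.inr c ∈ X) ∩ N, ?_, ?_⟩
    · rw [hgood, Finset.mem_filter, Finset.mem_powerset]
      exact ⟨Finset.inter_subset_right, hX.2⟩
    · rw [Finset.mem_filter]
      refine ⟨Finset.mem_univ _, ?_⟩
      intro x hx
      rw [Finset.mem_map] at hx
      obtain ⟨c, hc, rfl⟩ := hx
      exact (Finset.mem_filter.1 (Finset.mem_inter.1 hc).1).2
  have hstep1 := (Finset.sum_le_sum_of_subset_of_nonneg hcover fun X _ _ => hμnn X).trans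
      (sum_biUnion_le_sum_gen good _ μ hμnn)
  have hstep2 : ∀ T ∈ good,
      ∑ X ∈ univ.filter (fun X : Finset (Q ⊕ C) => T.map Function.Embedding.inr ⊆ X), μ X ≤ q ^ ⌈w / c₀⌉₊ := by
    intro T hT
    rw [hgood, Finset.mem_filter, Finset.mem_powerset] at hT
    refine (hμD T).trans ?_
    have hT' : w / c₀ ≤ (T.card : ℝ) := by rw [div_le_iff₀ hc₀]; linarith [hT.2]
    exact pow_le_pow_of_le_one hq0 hq1 (Nat.ceil_le.2 hT')
  have hstep3 : ∑ T ∈ good, ∑ X ∈ univ.filter (fun X : Finset (Q ⊕ C) => T.map Function.Embedding.inr ⊆ X), μ X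
      ≤ (good.card : ℝ) * q ^ ⌈w / c₀⌉₊ := by
    refine (Finset.sum_le_sum hstep2).trans ?_
    rw [Finset.sum_const, nsmul_eq_mul]
  have hgood_card : (good.card : ℝ) ≤ (2 : ℝ) ^ N.card := by
    have h1 : good.card ≤ N.powerset.card := Finset.card_filter_le _ _
    rw [Finset.card_powerset] at h1
    exact_mod_cast h1
  calc _ ≤ (good.card : ℝ) * q ^ ⌈w / c₀⌉₊ := hstep1.trans hstep3
    _ ≤ (2 : ℝ) ^ N.card * q ^ ⌈w / c₀⌉₊ := mul_le_mul_of_nonneg_right hgood_card (pow_nonneg hq0 _)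

omit [Fintype A] [Fintype B] [DecidableEq A] [DecidableEq B] in
/-- `Σ_{k=1}^{n} a^{k−1} b^k ≤ 2b` for `0 ≤ b` and `0 ≤ a` with `a·b ≤ 1/2`. [folklore] -/
private theorem geom_sum_le_two_mul' {a b : ℝ} (ha : 0 ≤ a) (hb0 : 0 ≤ b) (hab : a * b ≤ 1 / 2) (n : ℕ) :
    ∑ k ∈ Finset.Icc 1 n, a ^ (k - 1) * b ^ k ≤ 2 * b := by
  have hterm : ∀ k ∈ Finset.Icc 1 n, a ^ (k - 1) * b ^ k ≤ b * (1 / 2) ^ (k - 1) := by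
    intro k hk
    have hk1 : 1 ≤ k := (Finset.mem_Icc.1 hk).1
    have hsplit : a ^ (k - 1) * b ^ k = b * (a * b) ^ (k - 1) := by
      have : b ^ k = b * b ^ (k - 1) := by
        rw [← pow_succ']; congr 1; omega
      rw [this, mul_pow]; ring
    rw [hsplit]
    exact mul_le_mul_of_nonneg_left (pow_le_pow_left₀ (mul_nonneg ha hb0) hab _) hb0
  refine (Finset.sum_le_sum hterm).trans ?_
  rw [← Finset.mul_sum]
  have hgeom : ∑ k ∈ Finset.Icc 1 n, (1 / 2 : ℝ) ^ (k - 1) ≤ 2 := by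
    have hreindex : ∑ k ∈ Finset.Icc 1 n, (1 / 2 : ℝ) ^ (k - 1) = ∑ j ∈ Finset.range n, (1 / 2 : ℝ) ^ j := by
      have h := (Finset.sum_image (s := Finset.range n) (g := fun j => j + 1) (f := fun k => (1 / 2 : ℝ) ^ (k - 1))
        (by intro x _ y _ hxy; simpa using hxy))
      have himg : (Finset.range n).image (fun j => j + 1) = Finset.Icc 1 n := by
        ext k
        simp only [Finset.mem_image, Finset.mem_range, Finset.mem_Icc]
        constructor
        · rintro ⟨j, hj, rfl⟩; omega
        · intro hk; exact ⟨k - 1, by omega, by omega⟩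
      rw [himg] at h
      rw [h]
      exact Finset.sum_congr rfl fun j _ => by simp
    rw [hreindex, geom_sum_eq (by norm_num : (1 / 2 : ℝ) ≠ 1)]
    have h2 : ((1 / 2 : ℝ) ^ n - 1) / (1 / 2 - 1) = 2 * (1 - (1 / 2 : ℝ) ^ n) := by ring
    rw [h2]
    have : (0 : ℝ) ≤ (1 / 2 : ℝ) ^ n := by positivity
    linarith
  nlinarith

open scoped Classical in
/-- ★ **FGL18b Theorem 13, local-stochastic clause driven by the SYNDROME noise rate only.** As `fgl18b_theorem13_rooted`, but the law `μ` of the joint error is only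
assumed nonnegative with the syndrome-side bound `Σ_{X ⊇ T.map inr} μ X ≤ p_synd^{|T|}` (FGL18b Def. 9 with `S = ∅`): the residual `E_ls` restricted to succ is locally
stochastic with parameter `F(y)`, `y = 2^{max Δ}·p_synd^{1/c₀}` — the printed dependence on `p_synd` alone ("`K p_synd^{1/c₀}` where `K` is a constant independent of
`p_synd`"). See the module docstring for the precise rendering. Data: `Q_G`, any tree small-set-flip decoder `Dec`
(`0 < κ`, `2κ < min Δ·β₁`), any graph `𝒢` on `V ⊔ C_X` containing the qubit adjacency and the `H_X` incidences (for succ), a degree bound `Δ_Q` of the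
qubit adjacency graph `checkGraph (H_X; H_Z)` (for the `𝓜(S)` count), a locally stochastic law `μ` of parameter `p ∈ [0,1]` on the joint error,
`t` with `max Δ·t ≤ min Δ·min(γ_A n_A, γ_B n_B)`, and `y := 2^{max Δ}·p^{1/c₀} ≤ 1`, `c₀ = 4/(min Δ·β₁ − 2κ)`. Conclusion: there is
`E_ls : (joint errors) → 𝔽₂^V` with (i) `E_ls(X) ≡ E(X) ⊕ Dec(σ_X(E(X)) ⊕ 𝟙_{D(X)})` modulo `C_Z^⊥` whenever `¬ HasAlphaCluster 𝒢 α₀ (t+1) X`, and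
(ii) for every `S`, `Σ_{X : ¬HasAlphaCluster ∧ S ⊆ supp E_ls(X)} μ X ≤ (√y·(1 + Σ_{k=1}^{|V|} Δ_Q^{2(k−1)}(√y)^k))^{|S|}`.
Proof as printed: `E_ls(X)` = a minimum-weight word with the residual's syndrome (Lemma 26, parts 4–7); the witness of `S` = the components of
`supp E_ls(X)` meeting `S`, which lies in `𝓜(S)` and satisfies `|W| ≤ c₀|D ∩ Γ_X(W)|` (Lemma 26); union bound over `W ∈ 𝓜(S)` with
`ℙ[W witness] ≤ 2^{max Δ|W|}p^{⌈|W|/c₀⌉} ≤ y^{|W|}` (part 8) and `Σ_{W ∈ 𝓜(S)} y^{|W|} ≤ (√y(1 + F(√y)))^{|S|}` (`MarkedClusterFamilies`).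
[cite: FawziGrospellierLeverrier2018FT, Thm 13 (arXiv p0016 L66-73) and its proof (p0021 L23 – p0022 L20)] [cite: Gottesman2014, Lemma 2] -/
theorem fgl18b_theorem13_syndromeRate (H : Matrix B A (ZMod 2)) {dA dB : ℕ} {γA δA γB δB : ℝ}
    (hreg : IsBiregular H dA dB) (hexp : IsLeftRightExpanding H dA dB γA δA γB δB)
    (hdA : 0 < dA) (hdB : 0 < dB) (hδA : 0 ≤ δA) (hδB : 0 ≤ δB)
    {κ : ℝ} (hκ0 : 0 < κ) (hκ1 : 2 * κ < ((min dA dB : ℕ) : ℝ) * (1 - 16 * max δA δB))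
    (G' : SimpleGraph (((A × A) ⊕ (B × B)) ⊕ (A × B)))
    (hlift : ∀ q q', (checkGraph (Matrix.fromRows (expanderHX H) (expanderHZ H))).Adj q q' →
      G'.Adj (Sum.inl q) (Sum.inl q'))
    (hinc : ∀ c q, expanderHX H c q ≠ 0 → G'.Adj (Sum.inl q) (Sum.inr c))
    {ΔQ : ℕ} (hΔQ : ∀ q, (checkGraph (Matrix.fromRows (expanderHX H) (expanderHZ H))).degree q ≤ ΔQ)
    (Dec : Decoder (A × B → ZMod 2) ((A × A) ⊕ (B × B) → ZMod 2))
    (hDec : IsSSFDecoder κ (expanderHX H) (expanderHZ H) Dec)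
    {μ : Finset (((A × A) ⊕ (B × B)) ⊕ (A × B)) → ℝ} (hμnn : ∀ X, 0 ≤ μ X) {p : ℝ}
    (hμD : ∀ T : Finset (A × B),
      ∑ X ∈ univ.filter (fun X : Finset (((A × A) ⊕ (B × B)) ⊕ (A × B)) => T.map Function.Embedding.inr ⊆ X), μ X ≤ p ^ T.card)
    (hp0 : 0 ≤ p) (hp1 : p ≤ 1)
    {t : ℕ} (ht : ((max dA dB : ℕ) : ℝ) * t ≤ ((min dA dB : ℕ) : ℝ) * min (γA * Fintype.card A) (γB * Fintype.card B))
    :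
    ∃ eLs : Finset (((A × A) ⊕ (B × B)) ⊕ (A × B)) → ((A × A) ⊕ (B × B) → ZMod 2),
      (∀ X, ¬ HasAlphaCluster G' (κ / (2 * (κ + ((max dA dB : ℕ) : ℝ)))) (t + 1) X →
        eLs X + (flipVec (univ.filter fun q => Sum.inl q ∈ X)
          + Dec (expanderHX H *ᵥ flipVec (univ.filter fun q => Sum.inl q ∈ X)
              + flipVec (univ.filter fun c => Sum.inr c ∈ X))) ∈ rowSpace (expanderHZ H)) ∧
      ∀ S : Finset ((A × A) ⊕ (B × B)),
        ∑ X ∈ univ.filter (fun X => ¬ HasAlphaCluster G' (κ / (2 * (κ + ((max dA dB : ℕ) : ℝ)))) (t + 1) X ∧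
            S ⊆ supp (eLs X)), μ X
          ≤ (∑ k ∈ Finset.Icc 1 (Fintype.card ((A × A) ⊕ (B × B))), (ΔQ : ℝ) ^ (2 * (k - 1))
                * ((2 : ℝ) ^ (max dA dB) * p ^ (1 / (4 / (((min dA dB : ℕ) : ℝ) * (1 - 16 * max δA δB) - 2 * κ)))) ^ k)
            ^ S.card := by
  classical
  -- notation
  set Hs := expanderHX H with hHs
  set GQ := checkGraph (Matrix.fromRows (expanderHX H) (expanderHZ H)) with hGQ
  set α : ℝ := κ / (2 * (κ + ((max dA dB : ℕ) : ℝ))) with hαdef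
  set c : ℝ := 4 / (((min dA dB : ℕ) : ℝ) * (1 - 16 * max δA δB) - 2 * κ) with hcdef
  set y : ℝ := (2 : ℝ) ^ (max dA dB) * p ^ (1 / c) with hydef
  have hden : 0 < ((min dA dB : ℕ) : ℝ) * (1 - 16 * max δA δB) - 2 * κ := by linarith
  have hc0 : 0 < c := by rw [hcdef]; exact div_pos (by norm_num) hden
  have hy0 : 0 ≤ y := by rw [hydef]; exact mul_nonneg (pow_nonneg (by norm_num) _) (Real.rpow_nonneg hp0 _)
  let Epart : Finset (((A × A) ⊕ (B × B)) ⊕ (A × B)) → Finset ((A × A) ⊕ (B × B)) :=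
    fun X => univ.filter fun q => Sum.inl q ∈ X
  let Dpart : Finset (((A × A) ⊕ (B × B)) ⊕ (A × B)) → Finset (A × B) :=
    fun X => univ.filter fun c' => Sum.inr c' ∈ X
  have hparts : ∀ X, (Epart X).disjSum (Dpart X) = X := by
    intro X; ext x
    rw [Finset.mem_disjSum]
    constructor
    · rintro (⟨q, hq, rfl⟩ | ⟨c', hc, rfl⟩)
      · exact (Finset.mem_filter.1 hq).2
      · exact (Finset.mem_filter.1 hc).2
    · intro hx
      cases x with
      | inl q => exact Or.inl ⟨q, Finset.mem_filter.2 ⟨Finset.mem_univ _, hx⟩, rfl⟩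
      | inr c' => exact Or.inr ⟨c', Finset.mem_filter.2 ⟨Finset.mem_univ _, hx⟩, rfl⟩
  let resid : Finset (((A × A) ⊕ (B × B)) ⊕ (A × B)) → ((A × A) ⊕ (B × B) → ZMod 2) :=
    fun X => flipVec (Epart X) + Dec (Hs *ᵥ flipVec (Epart X) + flipVec (Dpart X))
  -- `E_ls(X)`: a minimum-weight word with the syndrome of the residual
  have hex : ∀ X, ∃ eLs : (A × A) ⊕ (B × B) → ZMod 2, Hs *ᵥ eLs = Hs *ᵥ resid X ∧
      ∀ v, Hs *ᵥ v = Hs *ᵥ eLs → hammingNorm eLs ≤ hammingNorm v :=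
    fun X => exists_minWeight_sameSyndrome Hs (resid X)
  choose eLs heLs using hex
  refine ⟨eLs, fun X hno => ?_, fun S => ?_⟩
  · -- (i) equivalence: part 7's argument
    obtain ⟨-, -, hequiv, -⟩ :=
      fgl18b_lemma26 H hreg hexp hdA hdB hδA hδB hκ0 hκ1 G' hlift hinc Dec hDec (Epart X) (Dpart X) ht
        (by rw [hparts]; exact hno)
    -- `fgl18b_lemma26` chose its own minimum-weight word; ours has the same syndrome and the same minimality, and
    -- the first half of Lemma 26 applies to it verbatim
    have hδ16 : max δA δB < 1 / 16 := by
      have hdm' : (0 : ℝ) < ((min dA dB : ℕ) : ℝ) := by exact_mod_cast lt_min hdA hdB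
      by_contra hge; push Not at hge
      have : ((min dA dB : ℕ) : ℝ) * (1 - 16 * max δA δB) ≤ 0 := mul_nonpos_of_nonneg_of_nonpos hdm'.le (by linarith)
      linarith
    have hδA' : δA < 1 / 6 := by linarith [le_max_left δA δB]
    have hδB' : δB < 1 / 6 := by linarith [le_max_right δA δB]
    refine fgl18b_lemma26_equiv H hreg hexp hdA hdB hδA hδA' hδB hδB' hκ0 Dec hDec (Epart X) (Dpart X) (eLs X)
      (heLs X).1 (heLs X).2 ?_
    intro K hK hineq
    have hdM0 : (0 : ℝ) ≤ ((max dA dB : ℕ) : ℝ) := Nat.cast_nonneg _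
    have hdM1 : (1 : ℝ) ≤ ((max dA dB : ℕ) : ℝ) := by exact_mod_cast le_trans hdA (le_max_left _ _)
    have hmM : ((min dA dB : ℕ) : ℝ) ≤ ((max dA dB : ℕ) : ℝ) := by exact_mod_cast min_le_max
    have hpos : (0 : ℝ) < 2 * (κ + ((max dA dB : ℕ) : ℝ)) := by positivity
    have hα' : κ / (2 * (κ + ((max dA dB : ℕ) : ℝ)))
          * ((K.card : ℝ) + (Dpart X ∩ univ.filter fun c' => ∃ q ∈ K, expanderHX H c' q ≠ 0).card)
        ≤ ((Epart X ∩ K).card : ℝ) + (Dpart X ∩ univ.filter fun c' => ∃ q ∈ K, expanderHX H c' q ≠ 0).card := by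
      rw [div_mul_eq_mul_div, div_le_iff₀ hpos]; linarith
    have hno' : ¬ HasAlphaCluster G' (κ / (2 * (κ + ((max dA dB : ℕ) : ℝ)))) (t + 1) ((Epart X).disjSum (Dpart X)) := by
      rw [hparts]; exact hno
    have hle := SmallSetFlip.card_le_of_not_hasAlphaCluster_mixed hlift hinc hno' K hK hα'
    have hKt : (K.card : ℝ) ≤ t := by exact_mod_cast le_trans (Nat.le_add_right _ _) hle
    have hmin0 : 0 ≤ min (γA * Fintype.card A) (γB * Fintype.card B) := by
      by_contra hneg; push Not at hneg
      have h1 : ((min dA dB : ℕ) : ℝ) * min (γA * Fintype.card A) (γB * Fintype.card B) < 0 :=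
        mul_neg_of_pos_of_neg (by exact_mod_cast lt_min hdA hdB) hneg
      have h2 : (0 : ℝ) ≤ ((max dA dB : ℕ) : ℝ) * t := by positivity
      linarith
    nlinarith [hKt, ht, hmM, hdM1, hmin0]
  · -- (ii) the union bound over witnesses
    -- components of `supp E_ls(X)` in the qubit graph, and the witness of `S`
    let joinedE : Finset (((A × A) ⊕ (B × B)) ⊕ (A × B)) → ((A × A) ⊕ (B × B)) → ((A × A) ⊕ (B × B)) → Prop :=
      fun X a b => Relation.ReflTransGen (fun u v => GQ.Adj u v ∧ u ∈ supp (eLs X) ∧ v ∈ supp (eLs X)) a b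
    let Wit : Finset (((A × A) ⊕ (B × B)) ⊕ (A × B)) → Finset ((A × A) ⊕ (B × B)) :=
      fun X => (supp (eLs X)).filter fun q => ∃ s ∈ S, joinedE X q s
    -- the family `𝓜(S)` in the qubit graph
    set MS : Finset (Finset ((A × A) ⊕ (B × B))) := univ.filter (fun W : Finset ((A × A) ⊕ (B × B)) => S ⊆ W ∧
        ∀ q ∈ W, ∃ s ∈ S, Relation.ReflTransGen (fun a b => GQ.Adj a b ∧ a ∈ W ∧ b ∈ W) q s) with hMS
    have hjsymm : ∀ {X} {a b : (A × A) ⊕ (B × B)}, joinedE X a b → joinedE X b a := by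
      intro X a b hab
      haveI : Std.Symm (fun u v => GQ.Adj u v ∧ u ∈ supp (eLs X) ∧ v ∈ supp (eLs X)) :=
        ⟨fun u v h => ⟨h.1.symm, h.2.2, h.2.1⟩⟩
      exact Std.Symm.symm _ _ hab
    -- (a) the witness is check-closed inside `supp E_ls(X)`
    have hWitX : ∀ X, ∀ q ∈ Wit X, ∀ q' ∈ supp (eLs X), ∀ c', expanderHX H c' q ≠ 0 → expanderHX H c' q' ≠ 0 →
        q' ∈ Wit X := by
      intro X q hq q' hq' c' h1 h2
      simp only [Wit, Finset.mem_filter] at hq ⊢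
      obtain ⟨hqE, s, hs, hqs⟩ := hq
      refine ⟨hq', s, hs, ?_⟩
      by_cases hqq : q' = q
      · rw [hqq]; exact hqs
      · have hadj : GQ.Adj q' q := (checkGraph_fromRows_adj_of_X H c' q q' (Ne.symm hqq) h1 h2).symm
        exact Relation.ReflTransGen.head ⟨hadj, hq', hqE⟩ hqs
    -- (b) the witness lies in `𝓜(S)` when `S ⊆ supp E_ls(X)`
    have hWitM : ∀ X, S ⊆ supp (eLs X) → Wit X ∈ MS := by
      intro X hS
      rw [hMS, Finset.mem_filter]
      refine ⟨Finset.mem_univ _, ?_, ?_⟩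
      · intro s hs
        simp only [Wit, Finset.mem_filter]
        exact ⟨hS hs, s, hs, Relation.ReflTransGen.refl⟩
      · intro q hq
        simp only [Wit, Finset.mem_filter] at hq
        obtain ⟨hqE, s, hs, hqs⟩ := hq
        refine ⟨s, hs, ?_⟩
        -- a path inside `supp E_ls(X)` from `q` to `s` stays inside the witness
        refine Relation.ReflTransGen.head_induction_on hqs Relation.ReflTransGen.refl ?_
        intro a b hab hbs ih
        have haW : a ∈ Wit X := by
          simp only [Wit, Finset.mem_filter]
          exact ⟨hab.2.1, s, hs, Relation.ReflTransGen.head hab hbs⟩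
        have hbW : b ∈ Wit X := by
          simp only [Wit, Finset.mem_filter]
          exact ⟨hab.2.2, s, hs, hbs⟩
        exact Relation.ReflTransGen.head ⟨hab.1, haW, hbW⟩ ih
    -- (c) the witness inequality (Lemma 26) outside the percolation event
    have hWitIneq : ∀ X, ¬ HasAlphaCluster G' α (t + 1) X →
        ((Wit X).card : ℝ) ≤ c * ((Dpart X ∩ univ.filter fun c' => ∃ q ∈ Wit X, expanderHX H c' q ≠ 0).card : ℝ) := by
      intro X hno
      have hno' : ¬ HasAlphaCluster G' α (t + 1) ((Epart X).disjSum (Dpart X)) := by rw [hparts]; exact hno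
      exact fgl18b_lemma26_witness_of_not_hasAlphaCluster H hreg hexp hdA hdB hδA hδB hκ0 hκ1 G' hlift hinc Dec hDec
        (Epart X) (Dpart X) ht hno' (eLs X) (heLs X).1 (heLs X).2 (Wit X) (Finset.filter_subset _ _) (hWitX X)
    -- (d) cover the event by the witness events, indexed by `W ∈ 𝓜(S)`
    have hcover : univ.filter (fun X => ¬ HasAlphaCluster G' α (t + 1) X ∧ S ⊆ supp (eLs X))
        ⊆ MS.biUnion fun W => univ.filter fun X : Finset (((A × A) ⊕ (B × B)) ⊕ (A × B)) =>
            (W.card : ℝ) ≤ c * ((Dpart X ∩ univ.filter fun c' => ∃ q ∈ W, expanderHX H c' q ≠ 0).card : ℝ) := by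
      intro X hX
      rw [Finset.mem_filter] at hX
      rw [Finset.mem_biUnion]
      exact ⟨Wit X, hWitM X hX.2.2, Finset.mem_filter.2 ⟨Finset.mem_univ _, hWitIneq X hX.2.1⟩⟩
    have hstep1 : ∑ X ∈ univ.filter (fun X => ¬ HasAlphaCluster G' α (t + 1) X ∧ S ⊆ supp (eLs X)), μ X
        ≤ ∑ W ∈ MS, ∑ X ∈ univ.filter (fun X : Finset (((A × A) ⊕ (B × B)) ⊕ (A × B)) =>
            (W.card : ℝ) ≤ c * ((Dpart X ∩ univ.filter fun c' => ∃ q ∈ W, expanderHX H c' q ≠ 0).card : ℝ)), μ X :=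
      (Finset.sum_le_sum_of_subset_of_nonneg hcover fun X _ _ => hμnn X).trans
        (sum_biUnion_le_sum_gen MS _ μ hμnn)
    -- (e) each witness event has weight `≤ y^{|W|}`
    have hstep2 : ∀ W ∈ MS, ∑ X ∈ univ.filter (fun X : Finset (((A × A) ⊕ (B × B)) ⊕ (A × B)) =>
        (W.card : ℝ) ≤ c * ((Dpart X ∩ univ.filter fun c' => ∃ q ∈ W, expanderHX H c' q ≠ 0).card : ℝ)), μ X
        ≤ y ^ W.card := by
      intro W _
      have h1 := sum_filter_witness_le_of_syndromeBound (Q := (A × A) ⊕ (B × B)) hμnn hμD hp0 hp1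
        (univ.filter fun c' : A × B => ∃ q ∈ W, expanderHX H c' q ≠ 0) (w := (W.card : ℝ)) hc0
      refine h1.trans ?_
      -- `2^{|Γ_X(W)|} ≤ (2^{max Δ})^{|W|}` and `p^{⌈|W|/c⌉} ≤ (p^{1/c})^{|W|}`
      have hN : (2 : ℝ) ^ (univ.filter fun c' : A × B => ∃ q ∈ W, expanderHX H c' q ≠ 0).card
          ≤ ((2 : ℝ) ^ (max dA dB)) ^ W.card := by
        rw [← pow_mul]
        exact pow_le_pow_right₀ (by norm_num) (card_checkNbhd_le H hreg W)
      have hP : p ^ ⌈(W.card : ℝ) / c⌉₊ ≤ (p ^ (1 / c)) ^ W.card := by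
        rw [← Real.rpow_natCast p, ← Real.rpow_natCast (p ^ (1 / c)), ← Real.rpow_mul hp0]
        refine Real.rpow_le_rpow_of_exponent_ge' hp0 hp1 (by positivity) ?_
        have : (1 / c) * (W.card : ℝ) = (W.card : ℝ) / c := by ring
        rw [this]
        exact Nat.le_ceil _
      calc (2 : ℝ) ^ (univ.filter fun c' : A × B => ∃ q ∈ W, expanderHX H c' q ≠ 0).card * p ^ ⌈(W.card : ℝ) / c⌉₊
          ≤ ((2 : ℝ) ^ (max dA dB)) ^ W.card * (p ^ (1 / c)) ^ W.card :=
            mul_le_mul hN hP (pow_nonneg hp0 _) (pow_nonneg (pow_nonneg (by norm_num) _) _)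
        _ = y ^ W.card := by rw [hydef, mul_pow]
    have hstep3 := (hstep1.trans (Finset.sum_le_sum hstep2))
    -- (f) the `𝓜(S)` bound, rooted form (no square-root loss)
    have hM := sum_pow_card_marked_le_rooted (G := GQ) hΔQ S hy0
    exact hstep3.trans hM


open scoped Classical in
/-- ★ **FGL18b Theorem 13 with the two rates of Def. 9** (succᶜ via the joint parameter `p`; `E_ls` parameter `K·p_synd^{1/c₀}`, `K = 2^{1+max Δ}`): for `Q_G`, any tree small-set-flip decoder (`0 < κ`,
`2κ < min Δ·β₁`), `𝒢 = syndromeAdjGraph H_X H_Z`, a locally stochastic joint law `μ` (parameter `p ∈ [0,1]`) on `V ⊔ C_X`, `α₀ = κ/(2(κ + max Δ))`,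
`c₀ = 4/(min Δ·β₁ − 2κ)`, `y = 2^{max Δ}·p^{1/c₀}`, `d' = 2max Δ(Δ_A+Δ_B−1)+Δ_A+Δ_B`, `Δ_Q = 2max Δ(Δ_A+Δ_B−1)`, `t` with `max Δ·t ≤ min Δ·min(γ_A n_A, γ_B n_B)`,
`r = 2d'²p^{α₀} < 1` and the small-noise condition `Δ_Q²·y ≤ 1/2`: there is `E_ls` with (i) `μ(HasAlphaCluster 𝒢 α₀ (t+1)) ≤ |V⊔C_X|·r^{t+1}/(d'²(1−r))`,
(ii) `E_ls ≡ E ⊕ Ê` outside that event, (iii) for every `S`, `Σ_{X outside, S ⊆ supp E_ls(X)} μ X ≤ (2^{1+max Δ}·p^{1/c₀})^{|S|}`.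
[cite: FawziGrospellierLeverrier2018FT, Thm 13 (arXiv p0016 L66-73) and its proof (p0021 L23 – p0022 L20)] [cite: Gottesman2014, Lemma 2] -/
theorem fgl18b_theorem13_twoRates (H : Matrix B A (ZMod 2)) {dA dB : ℕ} {γA δA γB δB : ℝ}
    (hreg : IsBiregular H dA dB) (hexp : IsLeftRightExpanding H dA dB γA δA γB δB)
    (hdA : 0 < dA) (hdB : 0 < dB) (hδA : 0 ≤ δA) (hδB : 0 ≤ δB)
    {κ : ℝ} (hκ0 : 0 < κ) (hκ1 : 2 * κ < ((min dA dB : ℕ) : ℝ) * (1 - 16 * max δA δB))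
    (Dec : Decoder (A × B → ZMod 2) ((A × A) ⊕ (B × B) → ZMod 2))
    (hDec : IsSSFDecoder κ (expanderHX H) (expanderHZ H) Dec)
    {μ : Finset (((A × A) ⊕ (B × B)) ⊕ (A × B)) → ℝ} {p q : ℝ} (hμ : IsLocallyStochastic μ p) (hp0 : 0 ≤ p) (hp1 : p ≤ 1)
    (hμD : ∀ T : Finset (A × B),
      ∑ X ∈ univ.filter (fun X : Finset (((A × A) ⊕ (B × B)) ⊕ (A × B)) => T.map Function.Embedding.inr ⊆ X), μ X ≤ q ^ T.card)
    (hq0 : 0 ≤ q) (hq1 : q ≤ 1)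
    {t : ℕ} (ht : ((max dA dB : ℕ) : ℝ) * t ≤ ((min dA dB : ℕ) : ℝ) * min (γA * Fintype.card A) (γB * Fintype.card B))
    (hsmall : ((2 * max dA dB * (dA + dB - 1) : ℕ) : ℝ) ^ 2
        * ((2 : ℝ) ^ (max dA dB) * q ^ (1 / (4 / (((min dA dB : ℕ) : ℝ) * (1 - 16 * max δA δB) - 2 * κ)))) ≤ 1 / 2)
    (hr : 2 * ((2 * max dA dB * (dA + dB - 1) + (dA + dB) : ℕ) : ℝ) ^ 2 * p ^ (κ / (2 * (κ + ((max dA dB : ℕ) : ℝ)))) < 1) :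
    ∃ eLs : Finset (((A × A) ⊕ (B × B)) ⊕ (A × B)) → ((A × A) ⊕ (B × B) → ZMod 2),
      (∑ X ∈ univ.filter (fun X =>
          HasAlphaCluster (SmallSetFlip.syndromeAdjGraph (expanderHX H) (expanderHZ H))
            (κ / (2 * (κ + ((max dA dB : ℕ) : ℝ)))) (t + 1) X), μ X
        ≤ (Fintype.card (((A × A) ⊕ (B × B)) ⊕ (A × B)) : ℝ)
            * (2 * ((2 * max dA dB * (dA + dB - 1) + (dA + dB) : ℕ) : ℝ) ^ 2 * p ^ (κ / (2 * (κ + ((max dA dB : ℕ) : ℝ))))) ^ (t + 1)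
          / (((2 * max dA dB * (dA + dB - 1) + (dA + dB) : ℕ) : ℝ) ^ 2
            * (1 - 2 * ((2 * max dA dB * (dA + dB - 1) + (dA + dB) : ℕ) : ℝ) ^ 2 * p ^ (κ / (2 * (κ + ((max dA dB : ℕ) : ℝ))))))) ∧
      (∀ X, ¬ HasAlphaCluster (SmallSetFlip.syndromeAdjGraph (expanderHX H) (expanderHZ H))
          (κ / (2 * (κ + ((max dA dB : ℕ) : ℝ)))) (t + 1) X →
        eLs X + (flipVec (univ.filter fun q => Sum.inl q ∈ X)
          + Dec (expanderHX H *ᵥ flipVec (univ.filter fun q => Sum.inl q ∈ X)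
              + flipVec (univ.filter fun c => Sum.inr c ∈ X))) ∈ rowSpace (expanderHZ H)) ∧
      ∀ S : Finset ((A × A) ⊕ (B × B)),
        ∑ X ∈ univ.filter (fun X =>
            ¬ HasAlphaCluster (SmallSetFlip.syndromeAdjGraph (expanderHX H) (expanderHZ H))
                (κ / (2 * (κ + ((max dA dB : ℕ) : ℝ)))) (t + 1) X ∧ S ⊆ supp (eLs X)), μ X
          ≤ (2 * ((2 : ℝ) ^ (max dA dB) * q ^ (1 / (4 / (((min dA dB : ℕ) : ℝ) * (1 - 16 * max δA δB) - 2 * κ)))))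
              ^ S.card := by
  classical
  set G' := SmallSetFlip.syndromeAdjGraph (expanderHX H) (expanderHZ H) with hG'
  have hlift : ∀ q q', (checkGraph (Matrix.fromRows (expanderHX H) (expanderHZ H))).Adj q q' → G'.Adj (Sum.inl q) (Sum.inl q') :=
    fun q q' h => (SmallSetFlip.syndromeAdjGraph_adj_inl_inl _ _ q q').2 h
  have hinc : ∀ c q, expanderHX H c q ≠ 0 → G'.Adj (Sum.inl q) (Sum.inr c) :=
    fun c q h => (SmallSetFlip.syndromeAdjGraph_adj_inl_inr _ _ q c).2 h
  have hΔQ : ∀ q, (checkGraph (Matrix.fromRows (expanderHX H) (expanderHZ H))).degree q ≤ 2 * max dA dB * (dA + dB - 1) :=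
    fun q => degree_checkGraph_fromRows_le_max H hreg q
  have hdeg : ∀ x, G'.degree x ≤ 2 * max dA dB * (dA + dB - 1) + (dA + dB) :=
    fun x => degree_syndromeAdjGraph_le H hreg x
  obtain ⟨eLs, hequiv, hls⟩ := fgl18b_theorem13_syndromeRate H hreg hexp hdA hdB hδA hδB hκ0 hκ1 G' hlift hinc hΔQ Dec hDec
    hμ.nonneg hμD hq0 hq1 ht
  refine ⟨eLs, ?_, hequiv, fun S => (hls S).trans ?_⟩
  · have hα0 : 0 < κ / (2 * (κ + ((max dA dB : ℕ) : ℝ))) := by positivity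
    have hd1 : 1 ≤ 2 * max dA dB * (dA + dB - 1) + (dA + dB) := by
      have : 1 ≤ dA + dB := le_trans hdA (Nat.le_add_right _ _)
      omega
    exact sum_hasAlphaCluster_le_geometric hdeg hd1 hμ hp0 hp1 hα0 (Nat.succ_le_succ (Nat.zero_le t)) hr
  · set y : ℝ := (2 : ℝ) ^ (max dA dB) * q ^ (1 / (4 / (((min dA dB : ℕ) : ℝ) * (1 - 16 * max δA δB) - 2 * κ))) with hy
    have hy0 : 0 ≤ y := mul_nonneg (pow_nonneg (by norm_num) _) (Real.rpow_nonneg hq0 _)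
    have hF : ∑ k ∈ Finset.Icc 1 (Fintype.card ((A × A) ⊕ (B × B))),
        ((2 * max dA dB * (dA + dB - 1) : ℕ) : ℝ) ^ (2 * (k - 1)) * y ^ k ≤ 2 * y := by
      have h := geom_sum_le_two_mul' (a := ((2 * max dA dB * (dA + dB - 1) : ℕ) : ℝ) ^ 2) (b := y) (by positivity) hy0 hsmall
        (Fintype.card ((A × A) ⊕ (B × B)))
      refine le_trans (le_of_eq ?_) h
      refine Finset.sum_congr rfl fun k _ => ?_
      rw [← pow_mul]
    have hF0 : 0 ≤ ∑ k ∈ Finset.Icc 1 (Fintype.card ((A × A) ⊕ (B × B))),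
        ((2 * max dA dB * (dA + dB - 1) : ℕ) : ℝ) ^ (2 * (k - 1)) * y ^ k := Finset.sum_nonneg fun k _ => by positivity
    exact pow_le_pow_left₀ hF0 hF _

end QuantumExpander

end Literature.InformationTheory.QuantumCodes
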